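import Summits.BirchSwinnertonDyer.BirchSwinnertonDyer.Theorems.ManinLocalTwoThreeKLineComponentsBounded
import HarnessLib

/-!
# (BI)_K, piece P5: the `3`-adic core in the SPLIT case — a `ℚ₃`-rational point of order `3`, and components when `r₃ ∈ (ℚ₃ˣ)²`
(route `ManinLocalTwoThree`, crux C3 `ManinPrimeToThreeAtNine` stmt-BirchSwinnertonDyer-22968 — residual RES₃♭, -an g39's `K`-line, stub (BI)_K
`UDCKummerLineK.KummerCubeRootThreeBoundedK`; cell bsd-f2-manin, prover seat p2 gen 18; `--supports stmt-BirchSwinnertonDyer-22968`)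

* `cubeRoot_threeAdicallyBounded_padic` — `V/ℤ₃` short (`a₁ = a₂ = a₃ = 0`) with elliptic generic fibre, `t ∈ qℤ₃⟦q⟧ ∖ 0`, `D₃ = [3](t) ≠ 0`,
  a `ℚ₃`-POINT `T = (X₁, Y₁)` with `Ψ₃(X₁) = 0`, `Y₁ ≠ 0`, tangent slope `λ` (`λ·2Y₁ = 3X₁² + a₄`), its tangent-line Kummer series
  `Θ = −x̂(D₃) − Y₁D₃³ − λ(x̂(D₃)D₃ − X₁D₃³)` with `3^{K₀}Θ ∈ ℤ₃⟦q⟧`: **every cube root `x ∈ ℚ₃⟦q⟧` of `Θ` has `3^{K₀}x ∈ ℤ₃⟦q⟧`.**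
  (p2 g17's `kummerTripling_padic`: `Θ·B³ = A³`, `A, B ∈ ℤ₃⟦q⟧`; then p3 g15's argument of `KummerCubeRootBounded.kummerCubeRoot_threeAdicallyBounded`
  verbatim: `(3^{K₀}A)³ = (3^{3K₀}Θ)B³` in the UFD `ℤ₃⟦q⟧` ⟹ `B ∣ 3^{K₀}A`; `μ₃(ℚ₃) = 1` and uniqueness of cube roots with constant term `−1`.)
* `components_threeAdicallyBounded_split` — the SPLIT twin of P3's `components_threeAdicallyBounded` (p739124): same data, but `r₃ = s²` with
  `s ∈ ℤ₃ˣ` instead of «`r₃` not a square»; the two `ℚ₃`-points `(X₁, ±ys)` (slopes `±ℓs`) have Kummer series `P ± sQ` with cube roots `U ± sV`,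
  both bounded by the first result, whence `U = ((U+sV) + (U−sV))/2` and `V = ((U+sV) − (U−sV))/(2s)` are (`2, s ∈ ℤ₃ˣ`).

HONEST FRAMING.  The `3`-adic core only; (BI)_K, KLINE, RES₃♭, C3, Manin's conjecture and BSD are NOT proved here.  No definitions, no sorry,
no new axioms. [cite: Washington1997, Thm. 7.3 and §7.1 (shape: `ℤ_p⟦T⟧` is a UFD — here Mathlib's `UniqueFactorizationMonoid R⟦X⟧`)]
[cite: SilvermanAEC2009, Exercise 3.7(d) and III.2.3 (shape)]
-/

set_option autoImplicit false
-- lint-debt: the directory name repeats the summit name (sibling precedent `ManinLocalTwoThreeKLineComponentsBounded.lean`)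
set_option linter.dupNamespace false

noncomputable section

open scoped Classical
open PowerSeries WeierstrassCurve Literature.NumberTheory.EllipticCurves

namespace Summit.BirchSwinnertonDyer.BirchSwinnertonDyer.Theorems.ManinLocalTwoThree.KLineBI

/-! ### §1 One `ℚ₃`-rational point of order `3` -/

/-- **Cube roots of the tangent-line Kummer series of a `ℚ₃`-point of order `3` are `3`-adically bounded** (by the same power of `3` that
bounds the series).  See the file header. [cite: Washington1997, Thm. 7.3 and §7.1 (shape)] -/
theorem cubeRoot_threeAdicallyBounded_padic (V : WeierstrassCurve ℤ_[3]) [hE : (V.map PadicInt.Coe.ringHom).IsElliptic]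
    (hEa₁ : (V.map PadicInt.Coe.ringHom).a₁ = 0) (hEa₂ : (V.map PadicInt.Coe.ringHom).a₂ = 0) (hEa₃ : (V.map PadicInt.Coe.ringHom).a₃ = 0)
    {t : ℚ_[3]⟦X⟧} (ht0 : constantCoeff t = 0) (htne : t ≠ 0) (htint : IsPadicInt t)
    (hDne : ((V.map PadicInt.Coe.ringHom).formalMul 3).subst t ≠ 0)
    {X₁ Y₁ lam : ℚ_[3]} (hY : Y₁ ≠ 0)
    (heq : Y₁ ^ 2 = X₁ ^ 3 + (V.map PadicInt.Coe.ringHom).a₄ * X₁ + (V.map PadicInt.Coe.ringHom).a₆)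
    (hψ : (V.map PadicInt.Coe.ringHom).Ψ₃.eval X₁ = 0)
    (hlam : lam * (2 * Y₁) = 3 * X₁ ^ 2 + (V.map PadicInt.Coe.ringHom).a₄)
    {Θ x : ℚ_[3]⟦X⟧}
    (hΘ : Θ = -(V.map PadicInt.Coe.ringHom).formalXMulSq.subst (((V.map PadicInt.Coe.ringHom).formalMul 3).subst t)
        - C Y₁ * ((V.map PadicInt.Coe.ringHom).formalMul 3).subst t ^ 3
        - C lam * ((V.map PadicInt.Coe.ringHom).formalXMulSq.subst (((V.map PadicInt.Coe.ringHom).formalMul 3).subst t)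
            * ((V.map PadicInt.Coe.ringHom).formalMul 3).subst t - C X₁ * ((V.map PadicInt.Coe.ringHom).formalMul 3).subst t ^ 3))
    (hx : x ^ 3 = Θ) {K₀ : ℕ} (hΘint : IsPadicInt (C ((3 : ℚ_[3]) ^ K₀) * Θ)) :
    IsPadicInt (C ((3 : ℚ_[3]) ^ K₀) * x) := by
  obtain ⟨D, hD⟩ : ∃ D : ℚ_[3]⟦X⟧, D = ((V.map PadicInt.Coe.ringHom).formalMul 3).subst t := ⟨_, rfl⟩
  rw [← hD] at hΘ
  have hD0 : constantCoeff D = 0 := by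
    rw [hD, Literature.RingTheory.FormalGroups.constantCoeff_subst_of_constantCoeff_eq_zero ht0, constantCoeff_formalMul]
  -- the point `T = (X₁, Y₁)` of order `3` and its tangent slope
  have heqE : (V.map PadicInt.Coe.ringHom).toAffine.Equation X₁ Y₁ := by
    rw [Affine.equation_iff, hEa₁, hEa₂, hEa₃]; linear_combination heq
  have hT : (V.map PadicInt.Coe.ringHom).toAffine.Nonsingular X₁ Y₁ := (Affine.equation_iff_nonsingular).mp heqE
  have h3T : 3 • Affine.Point.some X₁ Y₁ hT = 0 := by
    rw [← natCast_zsmul]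
    refine (Affine.Point.zsmul_some_eq_zero_iff hT 3).mpr ?_
    rw [WeierstrassCurve.ψ_three, Polynomial.evalEval_C]; exact hψ
  have hneg : Y₁ ≠ (V.map PadicInt.Coe.ringHom).toAffine.negY X₁ Y₁ := by
    rw [Affine.negY, hEa₁, hEa₃]; intro h
    apply hY; linear_combination (1 / 2 : ℚ_[3]) * h
  have hslope : (V.map PadicInt.Coe.ringHom).toAffine.slope X₁ X₁ Y₁ Y₁ = lam := by
    have hden : Y₁ - (V.map PadicInt.Coe.ringHom).toAffine.negY X₁ Y₁ = 2 * Y₁ := by rw [Affine.negY, hEa₁, hEa₃]; ring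
    rw [Affine.slope_of_Y_ne rfl hneg, hden, hEa₁, hEa₂, div_eq_iff (mul_ne_zero two_ne_zero hY), hlam]; ring
  -- the tripling `Θ·B³ = A³` over `ℤ₃⟦q⟧`
  obtain ⟨A, B, hB0, hAB⟩ := kummerTripling_padic V hT h3T ht0 htne htint hDne
  rw [← hD, hslope, ← hΘ] at hAB
  obtain ⟨κ, hκ⟩ : ∃ κ : ℤ_[3]⟦X⟧ →+* ℚ_[3]⟦X⟧, κ = PowerSeries.map (PadicInt.Coe.ringHom (p := 3)) := ⟨_, rfl⟩
  have hAB' : Θ * κ B ^ 3 = κ A ^ 3 := by rw [hκ]; exact hAB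
  have hκinj : Function.Injective κ := by rw [hκ]; exact PowerSeries.map_injective _ Subtype.val_injective
  have hκint : ∀ G : ℤ_[3]⟦X⟧, IsPadicInt (κ G) := fun G ↦ by
    rw [hκ]; exact isPadicInt_iff_exists_powerSeries_map.mpr ⟨G, rfl⟩
  have h3pow : ∀ m : ℕ, IsPadicInt (C ((3 : ℚ_[3]) ^ m) : ℚ_[3]⟦X⟧) := fun m ↦ by
    apply IsPadicInt.powerSeries_C
    rw [norm_pow]; exact pow_le_one₀ (norm_nonneg _) (le_of_lt (by simpa using Padic.norm_p_lt_one (p := 3)))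
  -- `G = 3^{3K₀}Θ ∈ ℤ₃⟦q⟧` and `(3^{K₀}A)³ = G·B³`, so `B ∣ 3^{K₀}A` in the UFD `ℤ₃⟦q⟧`
  have hK3 : IsPadicInt (C ((3 : ℚ_[3]) ^ (3 * K₀)) * Θ) := by
    have e : C ((3 : ℚ_[3]) ^ (3 * K₀)) * Θ = C ((3 : ℚ_[3]) ^ (2 * K₀)) * (C ((3 : ℚ_[3]) ^ K₀) * Θ) := by
      rw [← mul_assoc, ← map_mul, ← pow_add]; congr 3; ring
    rw [e]; exact (h3pow (2 * K₀)).mul hΘint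
  obtain ⟨G, hG⟩ := isPadicInt_iff_exists_powerSeries_map.mp hK3
  have h3κ : κ (C ((3 : ℤ_[3]) ^ K₀)) = C ((3 : ℚ_[3]) ^ K₀) := by rw [hκ, PowerSeries.map_C, map_pow, map_ofNat]
  have hR : (C ((3 : ℤ_[3]) ^ K₀) * A) ^ 3 = G * B ^ 3 := by
    apply hκinj
    have hG' : κ G = C ((3 : ℚ_[3]) ^ (3 * K₀)) * Θ := by rw [hκ]; exact hG
    rw [map_pow, map_mul, h3κ, map_mul, hG', map_pow κ B 3, mul_pow, ← hAB', ← map_pow, ← pow_mul']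
    ring
  obtain ⟨g, hg⟩ : B ∣ C ((3 : ℤ_[3]) ^ K₀) * A :=
    KummerCubeRootBounded.dvd_of_pow_three_dvd_pow_three ⟨G, by rw [hR, mul_comm]⟩
  -- `xx = 3^{-K₀}g` is a cube root of `Θ` with `xx(0) = −1`, hence `xx = x`
  have hB₃0 : κ B ≠ 0 := fun h0 ↦ hB0 (hκinj (by rw [h0, map_zero]))
  have h3K0 : ((3 : ℚ_[3]) ^ K₀) ≠ 0 := pow_ne_zero K₀ (by norm_num)
  obtain ⟨xx, hxxdef⟩ : ∃ xx : ℚ_[3]⟦X⟧, xx = C (((3 : ℚ_[3]) ^ K₀)⁻¹) * κ g := ⟨_, rfl⟩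
  have hBx : κ B * xx = κ A := by
    have h1 : C ((3 : ℚ_[3]) ^ K₀) * κ A = κ B * κ g := by rw [← h3κ, ← map_mul, hg, map_mul]
    have h2 : κ A = C (((3 : ℚ_[3]) ^ K₀)⁻¹) * (C ((3 : ℚ_[3]) ^ K₀) * κ A) := by
      rw [← mul_assoc, ← map_mul, inv_mul_cancel₀ h3K0, map_one, one_mul]
    rw [h2, h1, hxxdef]; ring
  have hxx3 : xx ^ 3 = Θ := by
    have e : κ B ^ 3 * xx ^ 3 = κ B ^ 3 * Θ := by rw [← mul_pow, hBx, ← hAB', mul_comm]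
    exact mul_left_cancel₀ (pow_ne_zero 3 hB₃0) e
  have hΘ0 : constantCoeff Θ = -1 := by
    rw [hΘ]
    simp only [map_sub, map_neg, map_mul, map_pow, constantCoeff_C, hD0,
      constantCoeff_formalXMulSq_subst (E := V.map PadicInt.Coe.ringHom) hD0]
    ring
  have hxx0 : constantCoeff xx = -1 := by
    apply KummerCubeRootBounded.eq_neg_one_of_pow_three_eq_neg_one
    rw [← map_pow, hxx3, hΘ0]
  have hx0 : constantCoeff x = -1 := by
    apply KummerCubeRootBounded.eq_neg_one_of_pow_three_eq_neg_one
    rw [← map_pow, hx, hΘ0]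
  have hxeq : x = xx :=
    KummerCubeRootBounded.cubeRoot_unique (by norm_num) (by rw [hx, hxx3]) (by rw [hx0, hxx0]) (by rw [hx0]; norm_num)
  rw [hxeq, hxxdef, ← mul_assoc, ← map_mul, mul_inv_cancel₀ h3K0, map_one, one_mul]
  exact hκint g

/-! ### §2 Components when `r₃` is a square -/

/-- **The `3`-adic core of (BI)_K in the split case** (`r₃ = s²`, `s ∈ ℤ₃ˣ`).  See the file header. [folklore] -/
theorem components_threeAdicallyBounded_split (V : WeierstrassCurve ℤ_[3]) [hE : (V.map PadicInt.Coe.ringHom).IsElliptic]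
    (hEa₁ : (V.map PadicInt.Coe.ringHom).a₁ = 0) (hEa₂ : (V.map PadicInt.Coe.ringHom).a₂ = 0) (hEa₃ : (V.map PadicInt.Coe.ringHom).a₃ = 0)
    {t : ℚ_[3]⟦X⟧} (ht0 : constantCoeff t = 0) (htne : t ≠ 0) (htint : IsPadicInt t)
    (hDne : ((V.map PadicInt.Coe.ringHom).formalMul 3).subst t ≠ 0)
    {r₃ s : ℚ_[3]} (hs : s ^ 2 = r₃) (hs1 : ‖s‖ = 1)
    {X₁ y ℓ : ℚ_[3]} (hy : y ≠ 0)
    (heq : y ^ 2 * r₃ = X₁ ^ 3 + (V.map PadicInt.Coe.ringHom).a₄ * X₁ + (V.map PadicInt.Coe.ringHom).a₆)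
    (hψ : (V.map PadicInt.Coe.ringHom).Ψ₃.eval X₁ = 0)
    (hℓ : ℓ * (2 * y * r₃) = 3 * X₁ ^ 2 + (V.map PadicInt.Coe.ringHom).a₄)
    {P Q U Vv : ℚ_[3]⟦X⟧}
    (hP : P = -(V.map PadicInt.Coe.ringHom).formalXMulSq.subst (((V.map PadicInt.Coe.ringHom).formalMul 3).subst t))
    (hQ : Q = -C y * ((V.map PadicInt.Coe.ringHom).formalMul 3).subst t ^ 3
        - C ℓ * ((V.map PadicInt.Coe.ringHom).formalXMulSq.subst (((V.map PadicInt.Coe.ringHom).formalMul 3).subst t)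
            * ((V.map PadicInt.Coe.ringHom).formalMul 3).subst t - C X₁ * ((V.map PadicInt.Coe.ringHom).formalMul 3).subst t ^ 3))
    (hU : U ^ 3 + 3 * C r₃ * U * Vv ^ 2 = P) (hV : 3 * U ^ 2 * Vv + C r₃ * Vv ^ 3 = Q)
    {K₀ : ℕ} (hPint : IsPadicInt (C ((3 : ℚ_[3]) ^ K₀) * P)) (hQint : IsPadicInt (C ((3 : ℚ_[3]) ^ K₀) * Q)) :
    ∃ K : ℕ, IsPadicInt (C ((3 : ℚ_[3]) ^ K) * U) ∧ IsPadicInt (C ((3 : ℚ_[3]) ^ K) * Vv) := by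
  have hs0 : s ≠ 0 := fun h ↦ by rw [h, norm_zero] at hs1; exact zero_ne_one hs1
  have h2 : ‖(2 : ℚ_[3])‖ = 1 := by
    rw [show (2 : ℚ_[3]) = ((2 : ℕ) : ℚ_[3]) by norm_num, Padic.norm_natCast_eq_one_iff]; decide
  -- both signs
  have key : ∀ ε : ℚ_[3], ε ^ 2 = 1 → ‖ε‖ = 1 → IsPadicInt (C ((3 : ℚ_[3]) ^ K₀) * (U + C (ε * s) * Vv)) := by
    intro ε hε hε1
    refine cubeRoot_threeAdicallyBounded_padic V hEa₁ hEa₂ hEa₃ ht0 htne htint hDne (X₁ := X₁) (Y₁ := ε * s * y)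
      (lam := ε * s * ℓ) ?_ ?_ hψ ?_ (Θ := P + C (ε * s) * Q) ?_ ?_ ?_
    · exact mul_ne_zero (mul_ne_zero (fun h ↦ by rw [h, zero_pow two_ne_zero] at hε; exact zero_ne_one hε) hs0) hy
    · rw [← heq, ← hs]; linear_combination (s ^ 2 * y ^ 2) * hε
    · rw [← hℓ, ← hs]; linear_combination (2 * s ^ 2 * ℓ * y) * hε
    · rw [hP, hQ]; simp only [map_mul]; ring
    · have hc2 : (C (ε * s) : ℚ_[3]⟦X⟧) ^ 2 = C r₃ := by rw [← map_pow, mul_pow, hε, hs, one_mul]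
      rw [← hU, ← hV, ← hc2]; ring
    · have e : C ((3 : ℚ_[3]) ^ K₀) * (P + C (ε * s) * Q) = C ((3 : ℚ_[3]) ^ K₀) * P + C (ε * s) * (C ((3 : ℚ_[3]) ^ K₀) * Q) := by
        ring
      rw [e]
      exact hPint.add ((IsPadicInt.powerSeries_C (by rw [norm_mul, hε1, hs1, mul_one])).mul hQint)
  have hK₁ := key 1 (one_pow 2) norm_one
  have hK₂ := key (-1) neg_one_sq (by rw [norm_neg, norm_one])
  refine ⟨K₀, ?_, ?_⟩
  · have e2 : C (2 : ℚ_[3]) * (C ((3 : ℚ_[3]) ^ K₀) * U) =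
        C ((3 : ℚ_[3]) ^ K₀) * (U + C ((1 : ℚ_[3]) * s) * Vv) + C ((3 : ℚ_[3]) ^ K₀) * (U + C ((-1 : ℚ_[3]) * s) * Vv) := by
      simp only [map_mul, map_neg, map_one, map_ofNat]; ring
    have hW : IsPadicInt (C (2 : ℚ_[3]) * (C ((3 : ℚ_[3]) ^ K₀) * U)) := by rw [e2]; exact hK₁.add hK₂
    have e3 : C ((3 : ℚ_[3]) ^ K₀) * U = C ((2 : ℚ_[3])⁻¹) * (C (2 : ℚ_[3]) * (C ((3 : ℚ_[3]) ^ K₀) * U)) := by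
      rw [← mul_assoc, ← map_mul, inv_mul_cancel₀ two_ne_zero, map_one, one_mul]
    rw [e3]; exact (IsPadicInt.powerSeries_C (by rw [norm_inv, h2, inv_one])).mul hW
  · have e2 : C (2 * s : ℚ_[3]) * (C ((3 : ℚ_[3]) ^ K₀) * Vv) =
        C ((3 : ℚ_[3]) ^ K₀) * (U + C ((1 : ℚ_[3]) * s) * Vv) - C ((3 : ℚ_[3]) ^ K₀) * (U + C ((-1 : ℚ_[3]) * s) * Vv) := by
      simp only [map_mul, map_neg, map_one, map_ofNat]; ring
    have hW : IsPadicInt (C (2 * s : ℚ_[3]) * (C ((3 : ℚ_[3]) ^ K₀) * Vv)) := by rw [e2]; exact hK₁.sub hK₂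
    have h2s : (2 * s : ℚ_[3]) ≠ 0 := mul_ne_zero two_ne_zero hs0
    have e3 : C ((3 : ℚ_[3]) ^ K₀) * Vv = C ((2 * s : ℚ_[3])⁻¹) * (C (2 * s : ℚ_[3]) * (C ((3 : ℚ_[3]) ^ K₀) * Vv)) := by
      rw [← mul_assoc, ← map_mul, inv_mul_cancel₀ h2s, map_one, one_mul]
    rw [e3]; exact (IsPadicInt.powerSeries_C (by rw [norm_inv, norm_mul, h2, hs1, mul_one, inv_one])).mul hW

end Summit.BirchSwinnertonDyer.BirchSwinnertonDyer.Theorems.ManinLocalTwoThree.KLineBI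

end
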